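import Summits.HubbardSuperconductivity.HubbardSuperconductivity.Theorems.DeformationLadderLowEnergyRigidityTelescopePoincare

/-!
# Route `DeformationLadder`, crux `LowEnergyRigidity` (item `stmt-HubbardSuperconductivity-1892`):
# the Poincaré telescope — the sharp top step on the `4 × 4` cell torus

Support file (`--supports stmt-HubbardSuperconductivity-1892`) for the line `Sketch` (poincare-telescope
spine), stub `stub_topPoincare`, over the vocabulary of `DeformationLadderLowEnergyRigidityTelescopeDefs`
(`cellOf`, `cellPair`, `cellCoherence`, `cellDirichlet`) and the `2 × 2` machinery of
`DeformationLadderLowEnergyRigidityTelescopePoincare` (`square_poincare`, `expect_conjTranspose_mul_self`,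
`re_expect_sum`).

Main result `stub_topPoincare`: for every side `L` and every vector `φ`,
`16 Re⟨φ, 𝒞₄ φ⟩ − 8 Re⟨φ, 𝒟₄ φ⟩ ≤ Re⟨φ, Δ_dᴴ Δ_d φ⟩`,
the operator Poincaré inequality of the `4 × 4` cell torus `C₄ □ C₄` (spectral gap
`λ₁ = 2 − 2cos(2π/4) = 2`, constant `k²/λ₁ = 16/2 = 8`) in expectation form — the TOP step of the
dyadic telescope `4, 8, 16, …`, relating the cell coherence `𝒞₄` to the crux's LRO operator
`Δ_dᴴ Δ_d` itself.

Ingredients (all elementary, no commutativity of the cell pair fields and no Fourier analysis):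
* `sum_cellPair` — `Σ_b Δ_b = Δ_d` (the cells partition the torus sites; fiberwise sum over `cellOf`);
* `cycle_poincare`, `ring_poincare` — the Poincaré inequality of the `4`-cycle for four VECTORS,
  `4 Σ|a_y|² − 2 Σ|a_y − a_{y+1}|² ≤ |Σ a_y|²` (from `square_poincare`, cycle `a₀ – a₁ – a₂ – a₃ – a₀`);
* `four_sum_identity`, `four_sum_le`, `ring_sum_le` — Cauchy–Schwarz for four vectors,
  `|a+b+c+d|² ≤ 4(|a|²+|b|²+|c|²+|d|²)`, as the exact identity `4Σ|·|² − |Σ·|² = Σ_{pairs}|a_i − a_j|²`;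
* `torus_poincare` — the `C₄ □ C₄` inequality for sixteen vectors `v_{x,y}`:
  rows first (`|R_x|² ≥ 4 Σ_y |v_{x,y}|² − 2 Σ_y |v_{x,y} − v_{x,y+1}|²`, `R_x = Σ_y v_{x,y}`), then the
  cycle of the four row sums (`|Σ_x R_x|² ≥ 4 Σ_x |R_x|² − 2 Σ_x |R_x − R_{x+1}|²`) with
  `|R_x − R_{x+1}|² ≤ 4 Σ_y |v_{x,y} − v_{x+1,y}|²`; total `|Σ v|² ≥ 16 Σ|v|² − 8 Σ_{directed bonds}`,
  the bond set being exactly that of `cellDirichlet L 4` (`b → b + e₀`, `b → b + e₁`);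
* `stub_topPoincare` — with `v_b = Δ_b φ`, `⟨φ, AᴴA φ⟩ = |A φ|²` and `Δ_d φ = Σ_b Δ_b φ`.
All elementary [folklore]; source of the construction: the idea card poincare-telescope (2026-08-16).
-/

noncomputable section

namespace Summit.HubbardSuperconductivity.HubbardSuperconductivity.Theorems.LowEnergyRigidity.Telescope

set_option linter.dupNamespace false -- summit = problem name (single-conjunct summit), D-0017

open Matrix
open scoped ComplexOrder
open Literature.MathematicalPhysics.QuantumLattice Literature.Probability.LatticeModels

/-! ### The cells partition the torus: `Σ_b Δ_b = Δ_d` -/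

/-- The cell pair fields sum to the whole `d`-wave pair field: `Σ_b cellPair L k b = pairField`
(every site lies in exactly one cell). [folklore] -/
theorem sum_cellPair (L : ℕ) [NeZero L] (k : ℕ) [NeZero k] :
    ∑ b : TorusSite 2 k, cellPair L k b = pairField dWaveFormFactor L := by
  unfold cellPair pairField
  exact Finset.sum_fiberwise Finset.univ (cellOf L k) fun x => localPair dWaveFormFactor L x

/-! ### Vector inequalities: the `4`-cycle, Cauchy–Schwarz, and the `4 × 4` torus -/

section Vectors

variable {n : Type*} [Fintype n]

/-- `|a − b|² = |b − a|²`. [folklore] -/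
theorem star_sub_dotProduct_sub_comm (a b : n → ℂ) :
    star (a - b) ⬝ᵥ (a - b) = star (b - a) ⬝ᵥ (b - a) := by
  rw [← neg_sub b a, star_neg, neg_dotProduct_neg]

/-- The Poincaré inequality of the `4`-cycle `a₀ – a₁ – a₂ – a₃ – a₀` for four vectors (spectral gap `2`):
`4 Σ|a_y|² − 2 Σ|a_y − a_{y+1}|² ≤ |a₀ + a₁ + a₂ + a₃|²` (from `square_poincare`). [folklore] -/
theorem cycle_poincare (a₀ a₁ a₂ a₃ : n → ℂ) :
    4 * ((star a₀ ⬝ᵥ a₀).re + (star a₁ ⬝ᵥ a₁).re + (star a₂ ⬝ᵥ a₂).re + (star a₃ ⬝ᵥ a₃).re)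
      - 2 * ((star (a₀ - a₁) ⬝ᵥ (a₀ - a₁)).re + (star (a₁ - a₂) ⬝ᵥ (a₁ - a₂)).re
          + (star (a₂ - a₃) ⬝ᵥ (a₂ - a₃)).re + (star (a₃ - a₀) ⬝ᵥ (a₃ - a₀)).re)
      ≤ (star (a₀ + a₁ + a₂ + a₃) ⬝ᵥ (a₀ + a₁ + a₂ + a₃)).re := by
  have h := square_poincare a₀ a₁ a₃ a₂
  rw [star_sub_dotProduct_sub_comm a₀ a₃, star_sub_dotProduct_sub_comm a₃ a₂,
    show a₀ + a₁ + a₃ + a₂ = a₀ + a₁ + a₂ + a₃ by abel] at h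
  linarith

/-- Cauchy–Schwarz for four vectors as an exact identity:
`4(|a|²+|b|²+|c|²+|d|²) − |a+b+c+d|² = Σ_{pairs} |a_i − a_j|²`. [folklore] -/
theorem four_sum_identity (a b c d : n → ℂ) :
    4 * (star a ⬝ᵥ a + star b ⬝ᵥ b + star c ⬝ᵥ c + star d ⬝ᵥ d)
      - star (a + b + c + d) ⬝ᵥ (a + b + c + d)
      = star (a - b) ⬝ᵥ (a - b) + star (a - c) ⬝ᵥ (a - c) + star (a - d) ⬝ᵥ (a - d)
        + star (b - c) ⬝ᵥ (b - c) + star (b - d) ⬝ᵥ (b - d) + star (c - d) ⬝ᵥ (c - d) := by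
  simp only [star_add, star_sub, add_dotProduct, sub_dotProduct, dotProduct_add, dotProduct_sub]
  ring

/-- Cauchy–Schwarz for four vectors: `|a+b+c+d|² ≤ 4(|a|²+|b|²+|c|²+|d|²)`. [folklore] -/
theorem four_sum_le (a b c d : n → ℂ) :
    (star (a + b + c + d) ⬝ᵥ (a + b + c + d)).re
      ≤ 4 * ((star a ⬝ᵥ a).re + (star b ⬝ᵥ b).re + (star c ⬝ᵥ c).re + (star d ⬝ᵥ d).re) := by
  have h := congrArg Complex.re (four_sum_identity a b c d)
  have h1 : 0 ≤ (star (a - b) ⬝ᵥ (a - b)).re := (Complex.nonneg_iff.mp (dotProduct_star_self_nonneg _)).1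
  have h2 : 0 ≤ (star (a - c) ⬝ᵥ (a - c)).re := (Complex.nonneg_iff.mp (dotProduct_star_self_nonneg _)).1
  have h3 : 0 ≤ (star (a - d) ⬝ᵥ (a - d)).re := (Complex.nonneg_iff.mp (dotProduct_star_self_nonneg _)).1
  have h4 : 0 ≤ (star (b - c) ⬝ᵥ (b - c)).re := (Complex.nonneg_iff.mp (dotProduct_star_self_nonneg _)).1
  have h5 : 0 ≤ (star (b - d) ⬝ᵥ (b - d)).re := (Complex.nonneg_iff.mp (dotProduct_star_self_nonneg _)).1
  have h6 : 0 ≤ (star (c - d) ⬝ᵥ (c - d)).re := (Complex.nonneg_iff.mp (dotProduct_star_self_nonneg _)).1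
  simp only [Complex.add_re, Complex.sub_re, Complex.mul_re, Complex.re_ofNat, Complex.im_ofNat,
    zero_mul, sub_zero] at h
  linarith

/-- Sums over `ℤ/4ℤ`, written out. [folklore] -/
theorem sum_zmod_four {M : Type*} [AddCommMonoid M] (f : ZMod 4 → M) :
    ∑ y, f y = f 0 + f 1 + f 2 + f 3 :=
  Fin.sum_univ_four f

/-- The Poincaré inequality of the cycle `ℤ/4ℤ` for a family of vectors `r : ℤ/4ℤ → ℂⁿ`, directed bonds
`y → y + 1`: `4 Σ_y |r_y|² − 2 Σ_y |r_y − r_{y+1}|² ≤ |Σ_y r_y|²`. [folklore] -/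
theorem ring_poincare (r : ZMod 4 → n → ℂ) :
    4 * ∑ y, (star (r y) ⬝ᵥ r y).re
      - 2 * ∑ y, (star (r y - r (y + 1)) ⬝ᵥ (r y - r (y + 1))).re
      ≤ (star (∑ y, r y) ⬝ᵥ ∑ y, r y).re := by
  have e3 : (3 : ZMod 4) + 1 = 0 := by decide
  simp only [sum_zmod_four, zero_add, one_add_one_eq_two, two_add_one_eq_three, e3]
  exact cycle_poincare (r 0) (r 1) (r 2) (r 3)

/-- Cauchy–Schwarz over `ℤ/4ℤ`: `|Σ_y r_y|² ≤ 4 Σ_y |r_y|²`. [folklore] -/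
theorem ring_sum_le (r : ZMod 4 → n → ℂ) :
    (star (∑ y, r y) ⬝ᵥ ∑ y, r y).re ≤ 4 * ∑ y, (star (r y) ⬝ᵥ r y).re := by
  simp only [sum_zmod_four]
  exact four_sum_le (r 0) (r 1) (r 2) (r 3)

/-- Sums over `Fin 2 → α` as iterated sums over the two coordinates. [folklore] -/
theorem sum_vecTwo {M : Type*} [AddCommMonoid M] {α : Type*} [Fintype α] (f : (Fin 2 → α) → M) :
    ∑ b, f b = ∑ x, ∑ y, f ![x, y] := by
  rw [← Fintype.sum_equiv (finTwoArrowEquiv α).symm (fun p => f ((finTwoArrowEquiv α).symm p)) f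
    fun _ => rfl, Fintype.sum_prod_type]
  rfl

/-- The `e₀`-neighbour of `(x, y)` is `(x + 1, y)`. [folklore] -/
theorem vecTwo_add_single_zero {α : Type*} [AddMonoid α] [One α] (x y : α) :
    (![x, y] : Fin 2 → α) + Pi.single 0 1 = ![x + 1, y] := by
  ext j
  fin_cases j <;> simp

/-- The `e₁`-neighbour of `(x, y)` is `(x, y + 1)`. [folklore] -/
theorem vecTwo_add_single_one {α : Type*} [AddMonoid α] [One α] (x y : α) :
    (![x, y] : Fin 2 → α) + Pi.single 1 1 = ![x, y + 1] := by
  ext j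
  fin_cases j <;> simp

/-- **The Poincaré inequality of the `4 × 4` torus `C₄ □ C₄` for sixteen vectors** `v : (ℤ/4ℤ)² → ℂⁿ`
(spectral gap `2`, constant `16/2 = 8`), over the directed bonds `b → b + eᵢ`:
`16 Σ_b |v_b|² − 8 Σ_b Σ_i |v_b − v_{b+eᵢ}|² ≤ |Σ_b v_b|²`. Rows by `ring_poincare`, then the cycle of
the four row sums by `ring_poincare` again, the differences of row sums bounded by `ring_sum_le`.
[folklore] -/
theorem torus_poincare (v : TorusSite 2 4 → n → ℂ) :
    16 * ∑ b, (star (v b) ⬝ᵥ v b).re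
      - 8 * ∑ b, ∑ i : Fin 2, (star (v b - v (b + Pi.single i 1)) ⬝ᵥ (v b - v (b + Pi.single i 1))).re
      ≤ (star (∑ b, v b) ⬝ᵥ ∑ b, v b).re := by
  simp only [sum_vecTwo, Fin.sum_univ_two, vecTwo_add_single_zero, vecTwo_add_single_one,
    Finset.sum_add_distrib]
  -- each row `x` is a `4`-cycle in the second coordinate
  have hrow : ∀ x : ZMod 4,
      4 * ∑ y, (star (v ![x, y]) ⬝ᵥ v ![x, y]).re
        - 2 * ∑ y, (star (v ![x, y] - v ![x, y + 1]) ⬝ᵥ (v ![x, y] - v ![x, y + 1])).re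
        ≤ (star (∑ y, v ![x, y]) ⬝ᵥ ∑ y, v ![x, y]).re :=
    fun x => ring_poincare fun y => v ![x, y]
  -- differences of consecutive row sums are controlled by the bonds in the first coordinate
  have hcol : ∀ x : ZMod 4,
      (star (∑ y, v ![x, y] - ∑ y, v ![x + 1, y]) ⬝ᵥ (∑ y, v ![x, y] - ∑ y, v ![x + 1, y])).re
        ≤ 4 * ∑ y, (star (v ![x, y] - v ![x + 1, y]) ⬝ᵥ (v ![x, y] - v ![x + 1, y])).re := by
    intro x
    rw [← Finset.sum_sub_distrib]
    exact ring_sum_le fun y => v ![x, y] - v ![x + 1, y]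
  -- the four row sums form a `4`-cycle in the first coordinate
  have hout :
      4 * ∑ x, (star (∑ y, v ![x, y]) ⬝ᵥ ∑ y, v ![x, y]).re
        - 2 * ∑ x, (star (∑ y, v ![x, y] - ∑ y, v ![x + 1, y]) ⬝ᵥ
            (∑ y, v ![x, y] - ∑ y, v ![x + 1, y])).re
        ≤ (star (∑ x, ∑ y, v ![x, y]) ⬝ᵥ ∑ x, ∑ y, v ![x, y]).re :=
    ring_poincare fun x => ∑ y, v ![x, y]
  have hrow' := Finset.sum_le_sum fun x (_ : x ∈ Finset.univ) => hrow x
  have hcol' := Finset.sum_le_sum fun x (_ : x ∈ Finset.univ) => hcol x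
  rw [Finset.sum_sub_distrib, ← Finset.mul_sum, ← Finset.mul_sum] at hrow'
  rw [← Finset.mul_sum] at hcol'
  linarith

end Vectors

/-! ### The top step of the telescope -/

/-- **Sharp top-scale torus Poincaré step** (stub `stub_topPoincare` of the line `Sketch`): for every side
`L` and every vector `φ`, `16 Re⟨φ, 𝒞₄ φ⟩ − 8 Re⟨φ, 𝒟₄ φ⟩ ≤ Re⟨φ, Δ_dᴴ Δ_d φ⟩` — the operator Poincaré
inequality of the `4 × 4` cell torus (`λ₁(C₄ □ C₄) = 2`, `k²/λ₁ = 8`) in expectation form, by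
`torus_poincare` for the sixteen vectors `Δ_b φ` and `Δ_d = Σ_b Δ_b` (`sum_cellPair`). [folklore] -/
theorem stub_topPoincare :
    ∀ (L : ℕ) [NeZero L] (φ : Fock (Orb (FermionTorus 2 L))),
      16 * (expect (cellCoherence L 4) φ).re - 8 * (expect (cellDirichlet L 4) φ).re ≤
        (expect ((pairField dWaveFormFactor L)ᴴ * pairField dWaveFormFactor L) φ).re := by
  intro L _ φ
  rw [← sum_cellPair L 4]
  unfold cellCoherence cellDirichlet
  simp only [re_expect_sum, expect_conjTranspose_mul_self, Matrix.sum_mulVec, Matrix.sub_mulVec]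
  exact torus_poincare fun b => cellPair L 4 b *ᵥ φ

end Summit.HubbardSuperconductivity.HubbardSuperconductivity.Theorems.LowEnergyRigidity.Telescope
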